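import Literature.MathematicalPhysics.QuantumLattice.GaussianAdiabaticWeight
import Literature.MathematicalPhysics.QuantumLattice.QuasiAdiabaticGenerator
import Literature.MathematicalPhysics.QuantumLattice.ApproximateEigenvectorLemmas
import HarnessLib

/-!
# The Gaussian quasi-adiabatic dressing `𝓖_a^H(A) = ∫ w_a(t) e^{itH} A e^{-itH} dt`

Hastings' Gaussian-filtered quasi-adiabatic continuation (Phys. Rev. B **69** (2004) 104431, §II;
Hastings–Wen, Phys. Rev. B **72** (2005) 045141, §II), as a map on finite matrices: the dressing
`A ↦ 𝓖_a^H(A) = ∫ w_a(t) τ_t^H(A) dt` with the Gaussian (error-function) weight `w_a` of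
`GaussianAdiabaticWeight.lean` (`w_a(t) = ½ sign(t) erfc(√a|t|)`, `|w_a(t)| ≤ ½e^{-at²}`,
`∫ w_a(t) e^{itν} dt = i(1 - e^{-ν²/(4a)})/ν`). It is the Gaussian counterpart of the exact
quasi-adiabatic generator `qaGenerator` (`QuasiAdiabaticGenerator.lean`, BMNS weight), trading
exactness of the intertwining for Gaussian decay in time — the mechanism behind the `C log L / L`
rate of the higher-dimensional Lieb–Schultz–Mattis theorem (Hastings 2004; Nachtergaele–Sims,
CMP **276** (2007), §2.2 and Lemma 5.5, where the same Gaussian filter appears as `B_{a,T}(A, H)`).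
Everything is PROVED for finite matrices (`Matrix n n ℂ`, `L²`-operator norm); one definition, no
named facts:

* `gqaGenerator a H A` (a Bochner integral); `norm_gqaGenerator_le`: `‖𝓖_a(A)‖ ≤ (√(π/a)/2)‖A‖`;
  `conjTranspose_gqaGenerator`: `𝓖(A)ᴴ = 𝓖(Aᴴ)`, so `i𝓖(X)` is Hermitian for anti-Hermitian `X`
  (`isHermitian_I_smul_gqaGenerator(_commutator)`); `gqaGenerator_mem_subalgebra` (strict locality
  for a strictly local `H`).
* **Approximate intertwining across the gap** (`gqaGenerator_approx_intertwines`): if `H` is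
  Hermitian with a unique ground state `ψ` (normalised) and gap `g ≥ γ > 0`, then for EVERY `A` the
  vector `ψ` is an approximate eigenvector of `M = A - i𝓖_a^H([A,H])`:
  `‖Mψ - ⟨ψ, Mψ⟩ψ‖₂ ≤ e^{-γ²/(4a)} ‖Aψ‖₂`. Proof by matrix elements in the eigenbasis:
  `vᵢ⋆·Mψ = e^{-(λᵢ-E₀)²/(4a)} vᵢ⋆·Aψ` off the ground state (`integral_gqaWeight_mul_cexp`), and
  Parseval. (Compare `qaGenerator_intertwines`: exact, `e^{…}` replaced by `0`.)
* **Locality** (`norm_gqaGenerator_sub_gqaGenerator_le`, `…_of_commutator`): if the dynamics of `H`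
  and `H'` agree on `A` up to `ε` for `|t| ≤ T`, then
  `‖𝓖_a^H(A) - 𝓖_a^{H'}(A)‖ ≤ ε √(π/a)/2 + 2‖A‖ e^{-aT²}/(2aT)` — Gaussian in `T`.

## References

* M. B. Hastings, Phys. Rev. B **69** (2004) 104431, §II. [HastingsPRB2004]
* M. B. Hastings, X.-G. Wen, Phys. Rev. B **72** (2005) 045141, §II. [HastingsWen2005]
* B. Nachtergaele, R. Sims, Comm. Math. Phys. **276** (2007) 437–472, §2.2, Lemma 5.5.
  [NachtergaeleSimsCMP2007]
* S. Bachmann, S. Michalakis, B. Nachtergaele, R. Sims, Comm. Math. Phys. **309** (2012) 835,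
  Prop. 2.4, Lemma 4.7 (the exact counterpart). [BachmannMichalakisNachtergaeleSimsCMP2012]
* The tree: `GaussianAdiabaticWeight` (the weight), `QuasiAdiabaticGenerator`
  (`integral_mem_subalgebra`, `heisenbergEvolution_mem_subalgebra`, `conjTransposeRealCLM`,
  `matrixElementCLM`, `star_eigenvectorBasis_dotProduct_heisenbergEvolution_mulVec`,
  `norm_heisenbergEvolution_sub_heisenbergEvolution_le_of_le`), `LiebRobinsonHastingsKomaSpectralProofs`
  (`exists_ground_index`, `sum_norm_sq_dotProduct_eigenvectorBasis`, `star_eigenvectorBasis_dotProduct`),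
  `ApproximateEigenvectorLemmas` (`eucNorm`).
-/

noncomputable section

open Real Complex Set Filter MeasureTheory
open scoped Topology ComplexConjugate

namespace Literature.MathematicalPhysics.QuantumLattice

open Matrix
open scoped Matrix.Norms.L2Operator

section Weight

variable {a : ℝ}

/-- For `a ≤ 0` the tail vanishes identically (junk case: `√(a/π) = 0`). [folklore] -/
theorem gqaTail_of_nonpos (ha : a ≤ 0) (s : ℝ) : gqaTail a s = 0 := by
  rw [gqaTail, Real.sqrt_eq_zero'.2 (div_nonpos_of_nonpos_of_nonneg ha pi_pos.le), zero_mul]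

/-- For `a ≤ 0` the weight vanishes identically (junk case). [folklore] -/
theorem gqaWeight_of_nonpos (ha : a ≤ 0) (t : ℝ) : gqaWeight a t = 0 := by
  rw [gqaWeight, gqaTail_of_nonpos ha, mul_zero]

end Weight

section Generator

variable {n : Type*} [Fintype n] [DecidableEq n]

/-! ### The dressing `𝓖_a^H(A) = ∫ w_a(t) τ_t^H(A) dt` -/

/-- **The Gaussian quasi-adiabatic dressing** `𝓖_a^H(A) = ∫ w_a(t) e^{itH} A e^{-itH} dt`
(Hastings 2004 §II with the Gaussian filter; the map `𝓘` of BMNS 2012 with the weight `W_γ`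
replaced by the error-function weight `w_a`). [cite: HastingsPRB2004, §II] -/
def gqaGenerator (a : ℝ) (H A : Matrix n n ℂ) : Matrix n n ℂ :=
  ∫ t, (gqaWeight a t : ℂ) • heisenbergEvolution H t A

/-- The integrand of the dressing is integrable (`w_a ∈ L¹`, `‖τ_t(A)‖ = ‖A‖`). [folklore] -/
theorem integrable_gqaWeight_smul_heisenbergEvolution {H : Matrix n n ℂ} (hH : H.IsHermitian)
    {a : ℝ} (ha : 0 < a) (A : Matrix n n ℂ) :
    Integrable fun t : ℝ => (gqaWeight a t : ℂ) • heisenbergEvolution H t A := by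
  refine ((integrable_gqaWeight ha).ofReal (𝕜 := ℂ)).smul_bdd (‖A‖)
    (heisenbergEvolution_continuous H A).aestronglyMeasurable
    (Filter.Eventually.of_forall fun t => ?_)
  rw [norm_heisenbergEvolution_holds hH t A]

/-- For `a ≤ 0` the weight vanishes and so does the dressing (junk case). [folklore] -/
theorem gqaGenerator_of_nonpos {a : ℝ} (ha : a ≤ 0) (H A : Matrix n n ℂ) : gqaGenerator a H A = 0 := by
  simp [gqaGenerator, gqaWeight_of_nonpos ha]

/-- **Norm bound** `‖𝓖_a^H(A)‖ ≤ (√(π/a)/2) ‖A‖`. [folklore] -/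
theorem norm_gqaGenerator_le {H : Matrix n n ℂ} (hH : H.IsHermitian) {a : ℝ} (ha : 0 < a)
    (A : Matrix n n ℂ) : ‖gqaGenerator a H A‖ ≤ Real.sqrt (π / a) / 2 * ‖A‖ := by
  unfold gqaGenerator
  calc ‖∫ t, (gqaWeight a t : ℂ) • heisenbergEvolution H t A‖
      ≤ ∫ t, ‖(gqaWeight a t : ℂ) • heisenbergEvolution H t A‖ := norm_integral_le_integral_norm _
    _ = ∫ t, |gqaWeight a t| * ‖A‖ := by
        refine congrArg (fun F : ℝ → ℝ => ∫ t, F t) (funext fun t => ?_)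
        rw [norm_smul, Complex.norm_real, Real.norm_eq_abs, norm_heisenbergEvolution_holds hH t A]
    _ = (∫ t, |gqaWeight a t|) * ‖A‖ := integral_mul_const _ _
    _ ≤ Real.sqrt (π / a) / 2 * ‖A‖ :=
        mul_le_mul_of_nonneg_right (integral_abs_gqaWeight_le ha) (norm_nonneg _)

/-- **The dressing is a `⋆`-map**: `𝓖(A)ᴴ = 𝓖(Aᴴ)` (the weight is real, `τ_t` is a `⋆`-map).
[folklore] -/
theorem conjTranspose_gqaGenerator {H : Matrix n n ℂ} (hH : H.IsHermitian) (a : ℝ)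
    (A : Matrix n n ℂ) : (gqaGenerator a H A)ᴴ = gqaGenerator a H Aᴴ := by
  rcases le_or_gt a 0 with ha | ha
  · simp [gqaGenerator_of_nonpos ha]
  unfold gqaGenerator
  have hint := integrable_gqaWeight_smul_heisenbergEvolution hH ha A
  have h := (conjTransposeRealCLM (n := n)).integral_comp_comm hint
  simp only [conjTransposeRealCLM_apply] at h
  rw [← h]
  refine congrArg (fun F : ℝ → Matrix n n ℂ => ∫ t, F t) (funext fun t => ?_)
  rw [conjTranspose_smul, heisenbergEvolution_conjTranspose hH, Complex.star_def, Complex.conj_ofReal]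

/-- `𝓖(-X) = -𝓖(X)`. [folklore] -/
theorem gqaGenerator_neg (a : ℝ) (H X : Matrix n n ℂ) : gqaGenerator a H (-X) = -gqaGenerator a H X := by
  simp only [gqaGenerator, heisenbergEvolution, Matrix.mul_neg, Matrix.neg_mul, smul_neg, integral_neg]

/-- `𝓖(X - Y) = 𝓖(X) - 𝓖(Y)` (`a > 0`). [folklore] -/
theorem gqaGenerator_sub {H : Matrix n n ℂ} (hH : H.IsHermitian) {a : ℝ} (ha : 0 < a)
    (X Y : Matrix n n ℂ) : gqaGenerator a H (X - Y) = gqaGenerator a H X - gqaGenerator a H Y := by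
  unfold gqaGenerator
  rw [← integral_sub (integrable_gqaWeight_smul_heisenbergEvolution hH ha X)
    (integrable_gqaWeight_smul_heisenbergEvolution hH ha Y)]
  refine congrArg (fun F : ℝ → Matrix n n ℂ => ∫ t, F t) (funext fun t => ?_)
  rw [heisenbergEvolution_sub, smul_sub]

/-- `𝓖(X + Y) = 𝓖(X) + 𝓖(Y)` (`a > 0`). [folklore] -/
theorem gqaGenerator_add {H : Matrix n n ℂ} (hH : H.IsHermitian) {a : ℝ} (ha : 0 < a)
    (X Y : Matrix n n ℂ) : gqaGenerator a H (X + Y) = gqaGenerator a H X + gqaGenerator a H Y := by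
  have h := gqaGenerator_sub hH ha (X + Y) Y
  rw [add_sub_cancel_right] at h
  rw [← sub_eq_iff_eq_add.1 h.symm]

/-- **`i 𝓖_a^H(X)` is Hermitian for anti-Hermitian `X`** (e.g. `X = [Q, H]`, or a boundary
current). [folklore] -/
theorem isHermitian_I_smul_gqaGenerator {H X : Matrix n n ℂ} (hH : H.IsHermitian)
    (hX : Xᴴ = -X) (a : ℝ) : (I • gqaGenerator a H X).IsHermitian := by
  unfold Matrix.IsHermitian
  rw [conjTranspose_smul, conjTranspose_gqaGenerator hH, hX, gqaGenerator_neg, Complex.star_def,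
    Complex.conj_I, neg_smul_neg]

/-- **`i 𝓖_a^H([Q,H])` is Hermitian** for Hermitian `Q`, `H`. [folklore] -/
theorem isHermitian_I_smul_gqaGenerator_commutator {H Q : Matrix n n ℂ} (hH : H.IsHermitian)
    (hQ : Q.IsHermitian) (a : ℝ) : (I • gqaGenerator a H (Q * H - H * Q)).IsHermitian := by
  refine isHermitian_I_smul_gqaGenerator hH ?_ a
  rw [conjTranspose_sub, conjTranspose_mul, conjTranspose_mul, hH.eq, hQ.eq]
  abel

/-- **The dressing preserves subalgebras**: if `H, A ∈ S` then `𝓖_a^H(A) ∈ S` (strict locality of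
the dressing for a strictly local Hamiltonian). [folklore] -/
theorem gqaGenerator_mem_subalgebra (S : Subalgebra ℂ (Matrix n n ℂ)) {H A : Matrix n n ℂ}
    (hH : H.IsHermitian) (hHS : H ∈ S) (hAS : A ∈ S) (a : ℝ) : gqaGenerator a H A ∈ S := by
  rcases le_or_gt a 0 with ha | ha
  · rw [gqaGenerator_of_nonpos ha]; exact S.zero_mem
  exact integral_mem_subalgebra S (integrable_gqaWeight_smul_heisenbergEvolution hH ha A)
    fun t => S.smul_mem (heisenbergEvolution_mem_subalgebra S hHS hAS t) _

/-! ### Approximate intertwining across the gap -/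

/-- **Matrix elements of the Gaussian dressing of `[A, H]` in the eigenbasis**: for `Hψ = E₀ψ` and
an eigenvector `vᵢ` with `λᵢ ≠ E₀`,
`vᵢ⋆ · 𝓖_a([A,H]) ψ = -i (1 - e^{-(λᵢ-E₀)²/(4a)}) (vᵢ⋆ · Aψ)`. Hastings (2004) §II, eqs.
(10)–(13). [folklore] -/
theorem star_eigenvectorBasis_dotProduct_gqaGenerator_commutator_mulVec {H : Matrix n n ℂ}
    (hH : H.IsHermitian) {a : ℝ} (ha : 0 < a) (i : n) {ψ : n → ℂ} {E₀ : ℝ}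
    (hψ : H *ᵥ ψ = (E₀ : ℂ) • ψ) (hΔ : hH.eigenvalues i - E₀ ≠ 0) (A : Matrix n n ℂ) :
    star (⇑(hH.eigenvectorBasis i)) ⬝ᵥ (gqaGenerator a H (A * H - H * A) *ᵥ ψ) =
      -I * (1 - Real.exp (-(hH.eigenvalues i - E₀) ^ 2 / (4 * a))) *
        (star (⇑(hH.eigenvectorBasis i)) ⬝ᵥ (A *ᵥ ψ)) := by
  have hΔ0 : ((hH.eigenvalues i - E₀ : ℝ) : ℂ) ≠ 0 := by exact_mod_cast hΔ
  -- `vᵢ⋆ · [A,H] ψ = -Δ (vᵢ⋆ · Aψ)`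
  have hX : star (⇑(hH.eigenvectorBasis i)) ⬝ᵥ ((A * H - H * A) *ᵥ ψ) =
      -((hH.eigenvalues i - E₀ : ℝ) : ℂ) * (star (⇑(hH.eigenvectorBasis i)) ⬝ᵥ (A *ᵥ ψ)) := by
    rw [sub_mulVec, ← mulVec_mulVec, ← mulVec_mulVec, hψ, mulVec_smul, dotProduct_sub,
      dotProduct_smul, star_eigenvectorBasis_dotProduct_mulVec hH i, smul_eq_mul]
    push_cast
    ring
  have hint := integrable_gqaWeight_smul_heisenbergEvolution hH ha (A * H - H * A)
  have h1 := (matrixElementCLM (⇑(hH.eigenvectorBasis i)) ψ).integral_comp_comm hint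
  simp only [matrixElementCLM_apply] at h1
  rw [gqaGenerator, ← h1]
  have e : ∀ t : ℝ, star (⇑(hH.eigenvectorBasis i)) ⬝ᵥ
      (((gqaWeight a t : ℂ) • heisenbergEvolution H t (A * H - H * A)) *ᵥ ψ) =
      ((gqaWeight a t : ℂ) * cexp (((t * (hH.eigenvalues i - E₀) : ℝ) : ℂ) * I)) *
        (-((hH.eigenvalues i - E₀ : ℝ) : ℂ) * (star (⇑(hH.eigenvectorBasis i)) ⬝ᵥ (A *ᵥ ψ))) := by
    intro t
    rw [smul_mulVec, dotProduct_smul,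
      star_eigenvectorBasis_dotProduct_heisenbergEvolution_mulVec hH i hψ, hX, smul_eq_mul]
    ring
  simp_rw [e]
  rw [integral_mul_const, integral_gqaWeight_mul_cexp ha hΔ]
  field_simp

/-- **Approximate intertwining of the Gaussian dressing across a spectral gap** (Hastings 2004,
§II: the Gaussian-filtered quasi-adiabatic continuation follows the ground state up to errors
`e^{-cΔE²/a}`; compare the exact `qaGenerator_intertwines`). Let `H` be Hermitian with a unique
ground state and spectral gap `g ≥ γ > 0`, `ψ` a normalised ground-state vector and `a > 0`. Then
for EVERY matrix `A`, `ψ` is an approximate eigenvector of `M = A - i𝓖_a^H([A,H])`: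
`‖Mψ - ⟨ψ, Mψ⟩ ψ‖₂ ≤ e^{-γ²/(4a)} ‖Aψ‖₂`.
Proof: in the eigenbasis, `vᵢ⋆·Mψ = e^{-(λᵢ-E₀)²/(4a)} vᵢ⋆·Aψ` for `λᵢ ≠ E₀`
(`star_eigenvectorBasis_dotProduct_gqaGenerator_commutator_mulVec`), the ground component of
`Mψ - ⟨ψ,Mψ⟩ψ` vanishes, and Parseval. [cite: HastingsPRB2004, §II] -/
theorem gqaGenerator_approx_intertwines {H : Matrix n n ℂ} (hH : H.IsHermitian) {γ g a : ℝ}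
    (hγ : 0 < γ) (hγg : γ ≤ g) (ha : 0 < a) (hgap : H.HasSpectralGap g) {ψ : n → ℂ}
    (hψ : H.IsGroundStateVector ψ) (hψ1 : star ψ ⬝ᵥ ψ = 1) (A : Matrix n n ℂ) :
    eucNorm ((A - I • gqaGenerator a H (A * H - H * A)) *ᵥ ψ -
        (star ψ ⬝ᵥ ((A - I • gqaGenerator a H (A * H - H * A)) *ᵥ ψ)) • ψ) ≤
      Real.exp (-γ ^ 2 / (4 * a)) * eucNorm (A *ᵥ ψ) := by
  obtain ⟨i₀, c, hev0, hothers, hψc, hc⟩ := exists_ground_index hH hgap hψ hψ1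
  have hψeq : H *ᵥ ψ = (H.groundEnergy : ℂ) • ψ := hψ.2
  set M := A - I • gqaGenerator a H (A * H - H * A) with hM
  set w := M *ᵥ ψ - (star ψ ⬝ᵥ (M *ᵥ ψ)) • ψ with hw
  set v : n → (n → ℂ) := fun i => ⇑(hH.eigenvectorBasis i) with hv
  -- components of `ψ` along the eigenbasis
  have hψcomp : ∀ i, star (v i) ⬝ᵥ ψ = if i = i₀ then c else 0 := by
    intro i
    rw [hψc, dotProduct_smul, hv, star_eigenvectorBasis_dotProduct hH i i₀, smul_eq_mul]
    split_ifs <;> simp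
  -- off-ground components of `Mψ`
  have hcomp : ∀ i, i ≠ i₀ → star (v i) ⬝ᵥ (M *ᵥ ψ) =
      (Real.exp (-(hH.eigenvalues i - H.groundEnergy) ^ 2 / (4 * a)) : ℂ) *
        (star (v i) ⬝ᵥ (A *ᵥ ψ)) := by
    intro i hi
    have hΔpos : 0 < hH.eigenvalues i - H.groundEnergy := by
      have := hothers i hi; linarith
    rw [hM, sub_mulVec, dotProduct_sub, smul_mulVec, dotProduct_smul, hv,
      star_eigenvectorBasis_dotProduct_gqaGenerator_commutator_mulVec hH ha i hψeq hΔpos.ne' A,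
      smul_eq_mul]
    have hI : I * (-I * (1 - (Real.exp (-(hH.eigenvalues i - H.groundEnergy) ^ 2 / (4 * a)) : ℂ)) *
        (star (⇑(hH.eigenvectorBasis i)) ⬝ᵥ (A *ᵥ ψ))) =
        (1 - (Real.exp (-(hH.eigenvalues i - H.groundEnergy) ^ 2 / (4 * a)) : ℂ)) *
          (star (⇑(hH.eigenvectorBasis i)) ⬝ᵥ (A *ᵥ ψ)) := by
      rw [← mul_assoc, ← mul_assoc, mul_neg, Complex.I_mul_I, neg_neg, one_mul]
    rw [hI]
    ring
  -- components of `w`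
  have hwcomp : ∀ i, star (v i) ⬝ᵥ w =
      if i = i₀ then 0 else
        (Real.exp (-(hH.eigenvalues i - H.groundEnergy) ^ 2 / (4 * a)) : ℂ) *
          (star (v i) ⬝ᵥ (A *ᵥ ψ)) := by
    intro i
    rw [hw, dotProduct_sub, dotProduct_smul, hψcomp i, smul_eq_mul]
    split_ifs with hi
    · subst hi
      -- `ψ⋆·Mψ = conj(c) v₀⋆·Mψ` and `|c| = 1`
      have hstarψ : star ψ = starRingEnd ℂ c • star (v i) := by
        rw [hψc, star_smul]; rfl
      rw [hstarψ, smul_dotProduct, smul_eq_mul]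
      have : (star (v i) ⬝ᵥ (M *ᵥ ψ)) - starRingEnd ℂ c * (star (v i) ⬝ᵥ (M *ᵥ ψ)) * c =
          (star (v i) ⬝ᵥ (M *ᵥ ψ)) * (1 - starRingEnd ℂ c * c) := by ring
      rw [this, hc, sub_self, mul_zero]
    · rw [hcomp i hi, mul_zero, sub_zero]
  -- Parseval and the termwise bound
  have hterm : ∀ i, ‖star (v i) ⬝ᵥ w‖ ^ 2 ≤
      Real.exp (-γ ^ 2 / (4 * a)) ^ 2 * ‖star (v i) ⬝ᵥ (A *ᵥ ψ)‖ ^ 2 := by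
    intro i
    rw [hwcomp i]
    split_ifs with hi
    · rw [norm_zero, zero_pow two_ne_zero]
      positivity
    · have hΔγ : γ ≤ hH.eigenvalues i - H.groundEnergy := by have := hothers i hi; linarith
      rw [norm_mul, mul_pow, Complex.norm_real, Real.norm_eq_abs, abs_of_pos (Real.exp_pos _)]
      have hexp : Real.exp (-(hH.eigenvalues i - H.groundEnergy) ^ 2 / (4 * a)) ≤
          Real.exp (-γ ^ 2 / (4 * a)) := by
        refine Real.exp_le_exp.2 ?_
        rw [div_le_div_iff_of_pos_right (by positivity : (0:ℝ) < 4 * a)]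
        have h1 : γ ^ 2 ≤ (hH.eigenvalues i - H.groundEnergy) ^ 2 := pow_le_pow_left₀ hγ.le hΔγ 2
        linarith
      exact mul_le_mul_of_nonneg_right (pow_le_pow_left₀ (Real.exp_nonneg _) hexp 2) (by positivity)
  have hpars_w : eucNorm w ^ 2 = ∑ i, ‖star (v i) ⬝ᵥ w‖ ^ 2 := by
    rw [eucNorm, ← sum_norm_sq_dotProduct_eigenvectorBasis hH w]
  have hpars_A : eucNorm (A *ᵥ ψ) ^ 2 = ∑ i, ‖star (v i) ⬝ᵥ (A *ᵥ ψ)‖ ^ 2 := by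
    rw [eucNorm, ← sum_norm_sq_dotProduct_eigenvectorBasis hH (A *ᵥ ψ)]
  have hsq : eucNorm w ^ 2 ≤ (Real.exp (-γ ^ 2 / (4 * a)) * eucNorm (A *ᵥ ψ)) ^ 2 := by
    rw [mul_pow, hpars_w, hpars_A, Finset.mul_sum]
    exact Finset.sum_le_sum fun i _ => hterm i
  exact (pow_le_pow_iff_left₀ (eucNorm_nonneg _)
    (mul_nonneg (Real.exp_nonneg _) (eucNorm_nonneg _)) two_ne_zero).1 hsq

/-- **Approximate intertwining, operator form**: with `q = ⟨ψ, Mψ⟩`,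
`‖(A - i𝓖_a^H([A,H]))ψ - qψ‖₂ ≤ e^{-γ²/(4a)} ‖A‖` for a normalised ground state `ψ`.
[cite: HastingsPRB2004, §II] -/
theorem gqaGenerator_approx_intertwines' {H : Matrix n n ℂ} (hH : H.IsHermitian) {γ g a : ℝ}
    (hγ : 0 < γ) (hγg : γ ≤ g) (ha : 0 < a) (hgap : H.HasSpectralGap g) {ψ : n → ℂ}
    (hψ : H.IsGroundStateVector ψ) (hψ1 : star ψ ⬝ᵥ ψ = 1) (A : Matrix n n ℂ) :
    eucNorm ((A - I • gqaGenerator a H (A * H - H * A)) *ᵥ ψ -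
        (star ψ ⬝ᵥ ((A - I • gqaGenerator a H (A * H - H * A)) *ᵥ ψ)) • ψ) ≤
      Real.exp (-γ ^ 2 / (4 * a)) * ‖A‖ := by
  refine (gqaGenerator_approx_intertwines hH hγ hγg ha hgap hψ hψ1 A).trans ?_
  refine mul_le_mul_of_nonneg_left ?_ (Real.exp_nonneg _)
  have h := eucNorm_mulVec_le A ψ
  rwa [eucNorm_eq_one hψ1, mul_one] at h

/-! ### Locality of the dressing -/

/-- **Locality of the Gaussian dressing**: if the dynamics of `H` and `H'` agree on `A` up to `ε`
for times `|t| ≤ T` (`T > 0`), then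
`‖𝓖_a^H(A) - 𝓖_a^{H'}(A)‖ ≤ ε √(π/a)/2 + 2‖A‖ e^{-aT²}/(2aT)` — the second term being the
Gaussian time cut-off of Hastings (2004) / Nachtergaele–Sims (2007) Lemma 5.5. In the application
`H'` is the restriction of `H` to a neighbourhood of the support of `A`, `𝓖^{H'}(A)` is strictly
local (`gqaGenerator_mem_subalgebra`) and `ε` comes from a Lieb–Robinson bound. [folklore] -/
theorem norm_gqaGenerator_sub_gqaGenerator_le {H H' : Matrix n n ℂ} (hH : H.IsHermitian)
    (hH' : H'.IsHermitian) {a : ℝ} (ha : 0 < a) (A : Matrix n n ℂ) {T ε : ℝ} (hT : 0 < T)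
    (hε0 : 0 ≤ ε)
    (hε : ∀ t : ℝ, |t| ≤ T → ‖heisenbergEvolution H t A - heisenbergEvolution H' t A‖ ≤ ε) :
    ‖gqaGenerator a H A - gqaGenerator a H' A‖ ≤
      ε * (Real.sqrt (π / a) / 2) + 2 * ‖A‖ * (Real.exp (-a * T ^ 2) / (2 * a * T)) := by
  have hint := integrable_gqaWeight_smul_heisenbergEvolution hH ha A
  have hint' := integrable_gqaWeight_smul_heisenbergEvolution hH' ha A
  have hW := (integrable_gqaWeight ha).abs
  have hmeas : MeasurableSet {t : ℝ | T < |t|} := measurableSet_lt measurable_const continuous_abs.measurable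
  set D : ℝ → Matrix n n ℂ := fun t => heisenbergEvolution H t A - heisenbergEvolution H' t A with hD
  have hD2 : ∀ t, ‖D t‖ ≤ 2 * ‖A‖ := fun t => by
    calc ‖D t‖ ≤ ‖heisenbergEvolution H t A‖ + ‖heisenbergEvolution H' t A‖ := norm_sub_le _ _
      _ = 2 * ‖A‖ := by rw [norm_heisenbergEvolution_holds hH, norm_heisenbergEvolution_holds hH']; ring
  have hpt : ∀ t : ℝ, ‖(gqaWeight a t : ℂ) • heisenbergEvolution H t A -
      (gqaWeight a t : ℂ) • heisenbergEvolution H' t A‖ ≤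
      ε * |gqaWeight a t| + 2 * ‖A‖ * Set.indicator {t : ℝ | T < |t|} (fun t => |gqaWeight a t|) t := by
    intro t
    rw [← smul_sub, norm_smul, Complex.norm_real, Real.norm_eq_abs]
    change |gqaWeight a t| * ‖D t‖ ≤ _
    by_cases ht : |t| ≤ T
    · have h1 : |gqaWeight a t| * ‖D t‖ ≤ ε * |gqaWeight a t| := by
        rw [mul_comm]; exact mul_le_mul_of_nonneg_right (hε t ht) (abs_nonneg _)
      have h2 : 0 ≤ 2 * ‖A‖ * Set.indicator {t : ℝ | T < |t|} (fun t => |gqaWeight a t|) t :=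
        mul_nonneg (by positivity) (Set.indicator_nonneg (fun _ _ => abs_nonneg _) _)
      linarith
    · rw [Set.indicator_of_mem (show t ∈ {t : ℝ | T < |t|} from not_le.1 ht)]
      have h1 : |gqaWeight a t| * ‖D t‖ ≤ 2 * ‖A‖ * |gqaWeight a t| := by
        rw [mul_comm]; exact mul_le_mul_of_nonneg_right (hD2 t) (abs_nonneg _)
      have h2 : 0 ≤ ε * |gqaWeight a t| := mul_nonneg hε0 (abs_nonneg _)
      linarith
  have hrhs : Integrable fun t : ℝ =>
      ε * |gqaWeight a t| + 2 * ‖A‖ * Set.indicator {t : ℝ | T < |t|} (fun t => |gqaWeight a t|) t :=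
    (hW.const_mul ε).add ((hW.indicator hmeas).const_mul _)
  unfold gqaGenerator
  rw [← integral_sub hint hint']
  calc ‖∫ t, ((gqaWeight a t : ℂ) • heisenbergEvolution H t A -
        (gqaWeight a t : ℂ) • heisenbergEvolution H' t A)‖
      ≤ ∫ t, ‖(gqaWeight a t : ℂ) • heisenbergEvolution H t A -
          (gqaWeight a t : ℂ) • heisenbergEvolution H' t A‖ := norm_integral_le_integral_norm _
    _ ≤ ∫ t, (ε * |gqaWeight a t| +
          2 * ‖A‖ * Set.indicator {t : ℝ | T < |t|} (fun t => |gqaWeight a t|) t) :=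
        integral_mono (hint.sub hint').norm hrhs hpt
    _ = ε * (∫ t, |gqaWeight a t|) + 2 * ‖A‖ * ∫ t in {t : ℝ | T < |t|}, |gqaWeight a t| := by
        rw [integral_add (hW.const_mul ε) ((hW.indicator hmeas).const_mul _), integral_const_mul,
          integral_const_mul, integral_indicator hmeas]
    _ ≤ ε * (Real.sqrt (π / a) / 2) + 2 * ‖A‖ * (Real.exp (-a * T ^ 2) / (2 * a * T)) := by
        gcongr
        · exact integral_abs_gqaWeight_le ha
        · exact integral_abs_gqaWeight_tail_le ha hT

/-- **Locality of the dressing from a commutator (Lieb–Robinson-type) bound**: if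
`‖[τ_u^H(H - H'), A]‖ ≤ η` for all `|u| ≤ T` (`T > 0`), then
`‖𝓖_a^H(A) - 𝓖_a^{H'}(A)‖ ≤ ηT √(π/a)/2 + 2‖A‖ e^{-aT²}/(2aT)`. [folklore] -/
theorem norm_gqaGenerator_sub_gqaGenerator_le_of_commutator {H H' : Matrix n n ℂ}
    (hH : H.IsHermitian) (hH' : H'.IsHermitian) {a : ℝ} (ha : 0 < a) (A : Matrix n n ℂ)
    {T η : ℝ} (hT : 0 < T) (hη0 : 0 ≤ η)
    (hη : ∀ u : ℝ, |u| ≤ T →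
      ‖heisenbergEvolution H u (H - H') * A - A * heisenbergEvolution H u (H - H')‖ ≤ η) :
    ‖gqaGenerator a H A - gqaGenerator a H' A‖ ≤
      η * T * (Real.sqrt (π / a) / 2) + 2 * ‖A‖ * (Real.exp (-a * T ^ 2) / (2 * a * T)) := by
  refine norm_gqaGenerator_sub_gqaGenerator_le hH hH' ha A hT (mul_nonneg hη0 hT.le)
    (fun t ht => ?_)
  calc ‖heisenbergEvolution H t A - heisenbergEvolution H' t A‖ ≤ η * |t| :=
        norm_heisenbergEvolution_sub_heisenbergEvolution_le_of_le hH hH' A fun u hu => hη u (hu.trans ht)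
    _ ≤ η * T := mul_le_mul_of_nonneg_left ht hη0

end Generator

end Literature.MathematicalPhysics.QuantumLattice

end
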